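import Mathlib
import Literature.AlgebraicGeometry.HodgeTheory.WeilClasses
import Literature.AlgebraicGeometry.HodgeTheory.SemiregularityMap
import Literature.AlgebraicGeometry.HodgeTheory.ChernCharacterBetti
import Literature.AlgebraicGeometry.Motives.HyperbolicWeilType
import Summits.HodgeConjecture.HodgeConjecture.Theses.PadicSemiregularLift

/-!
# Sketch — crux `HodgeAbelianVarieties` (stmt-HodgeConjecture-1333), round 1, ideator 2

First lemmas of three crux ideas, stated over existing declarations:

* `weilAlgebraicHyperbolic_of_blochSeed` — card `subtorus-gallery-bloch-seeds`;
* `not_injective_of_blockAdditive`, `obstruction_eq_zero_of_isotypic` — cards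
  `subtorus-gallery-bloch-seeds` (interaction no-go) and `symmetry-ladder-isotypic-obstructions`;
* `ker_map_eq_of_ker_eq` — card `e-step-secant-induction` (Künneth stability of Markman's
  Hochschild criterion, linear-algebra core).
-/

namespace Summit.HodgeConjecture.HodgeConjecture.Cruxes.HodgeAbelianVarieties.IdeatorTwo

open CategoryTheory AlgebraicGeometry
open Literature.AlgebraicGeometry Literature.AlgebraicGeometry.Motives
  Literature.AlgebraicGeometry.HodgeTheory

/-- Weil classes of `(A, φ)` (`φ ≫ φ = -d`) in half-dimension `n` are algebraic: every rational
`(n,n)`-class of the complexified Weil plane `weilClassesOf A φ n d ⊆ H²ⁿ(A(ℂ);ℂ)` lies in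
`algebraicClasses A.X n` (same binder shape as the Weil-sector routes). -/
def WeilAlgebraicFor (n d : ℕ) (A : AbelianVariety ℂ) (φ : A ⟶ A) : Prop :=
  ∀ c ∈ weilClassesOf A φ n d, IsRationalClass c → IsOfHodgeType (2 * n) A.X (2 * n) n n c →
    c ∈ algebraicClasses A.X n

/-- SECTOR: Weil classes are algebraic on every `2n`-dimensional `(A, φ, h)` of HYPERBOLIC
(= split) Weil type for `K = ℚ(√-d)` (`IsHyperbolicWeilType`: a `K`-stable rational Lagrangian
`2n`-frame in `H¹` for `x ⌣ y ⌣ h^{2n-1}`), `h` a rational `(1,1)`-class (the polarization). -/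
def WeilAlgebraicHyperbolic (n d : ℕ) : Prop :=
  ∀ (A : AbelianVariety ℂ) (φ : A ⟶ A) (h : complexBetti A.X 2), A.dim = 2 * n →
    φ ≫ φ = -((d : ℤ) • 𝟙 A) → IsRationalClass h → IsOfHodgeType (2 * n) A.X 2 1 1 h →
      IsHyperbolicWeilType A φ n h → WeilAlgebraicFor n d A φ

/-- A BLOCH–WEIL SEED in dimension `2n` for `K = ℚ(√-d)`: some hyperbolic-type `(A₀, φ₀, h₀)`
(intended: the split CM anchor `E_K^{2n}` / `A'₀ ⊗ 𝒪_K`) carries a closed subscheme `ι : Z ↪ A₀`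
(intended: an lci GALLERY of translated `n`-dimensional abelian subvarieties, adjacent members
meeting along `(n-1)`-dimensional subtori) which is Bloch-semiregular in form degree `n - 1`
(codimension `n`; `SubschemeSemiregularityData`, `IsBlochSemiregular`) and whose fundamental class
`ch_n(𝒪_Z) = [Z]` is `a · h₀ⁿ + w` with `w` a NON-ZERO (complexified) Weil class. -/
def HasBlochWeilSeed (n d : ℕ) : Prop :=
  ∃ (A₀ : AbelianVariety ℂ) (φ₀ : A₀ ⟶ A₀) (h₀ : complexBetti A₀.X 2),
    A₀.dim = 2 * n ∧ φ₀ ≫ φ₀ = -((d : ℤ) • 𝟙 A₀) ∧ IsRationalClass h₀ ∧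
    IsOfHodgeType (2 * n) A₀.X 2 1 1 h₀ ∧ IsHyperbolicWeilType A₀ φ₀ n h₀ ∧
    ∃ (Z : Scheme.{0}) (ι : Z ⟶ A₀.X.left) (_ : IsClosedImmersion ι)
      (D : SubschemeSemiregularityData.{0} (2 * n) A₀.X ι),
      D.IsBlochSemiregular (n - 1) ∧
      ∃ (a : ℂ) (w : complexBetti A₀.X (2 * n)),
        w ∈ weilClassesOf A₀ φ₀ n d ∧ w ≠ 0 ∧ D.chernCharacterBetti n = a • cupPowTwo h₀ n + w

/-- FIRST LEMMA of card `subtorus-gallery-bloch-seeds` (Bloch 1972 semiregularity theorem in the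
variational form of Buchweitz–Flenner Prop. 8.2 / Thm. 2.1 of Markman's survey, + Baire / relative
Hilbert scheme + isogeny inside the hyperbolic genus (van Geemen; tree `WeilClassesIsogenyDescent`)):
one Bloch–Weil seed at one hyperbolic member gives the Weil classes on EVERY hyperbolic member of
dimension `2n`. Intended with the lci hypothesis on `Z` (carried informally: `T²_{Z/X} = H¹(N)`). -/
theorem weilAlgebraicHyperbolic_of_blochSeed (n d : ℕ) (hn : 2 ≤ n) (hd : 0 < d) :
    HasBlochWeilSeed n d → WeilAlgebraicHyperbolic n d := by
  sorry

/-- Link to the crux through descending (Koike/Markman §1.1 Step 2; tree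
`HodgeTheory.WeilClassesProducts`): hyperbolic `(2n+2)`-folds give ALL `2n`-folds (every
discriminant) — so the first new instance of the line is `n + 1 = 4`: eightfold seeds ⇒ sixfolds. -/
def WeilAlgebraicAll (n d : ℕ) : Prop :=
  ∀ (A : AbelianVariety ℂ) (φ : A ⟶ A), A.dim = 2 * n → φ ≫ φ = -((d : ℤ) • 𝟙 A) →
    WeilAlgebraicFor n d A φ

theorem weilAlgebraicAll_of_hyperbolic_succ (n d : ℕ) (hn : 1 ≤ n) (hd : 0 < d) :
    WeilAlgebraicHyperbolic (n + 1) d → WeilAlgebraicAll n d := by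
  sorry

/-! ### Interaction no-go (block additivity of `σ` + additivity of obstructions) -/

/-- ABSTRACT NO-GO (card `subtorus-gallery-bloch-seeds`, Lemma 1): if the semiregularity map `σ` of
`F = F₁ ⊕ F₂` restricts on the two diagonal blocks `ι₁ Ext²(F₁,F₁)`, `ι₂ Ext²(F₂,F₂)` to `σ₁`, `σ₂`
(Buchweitz–Flenner: Atiyah class and trace are additive), and the first-order obstructions along a
direction `v` of the Weil family are `ob = ι₁ ob₁ + ι₂ ob₂` (Huybrechts–Thomas: `ob = At ∪ κ_v`) with
`σ₁ ob₁ = ∇_v ch(F₁) ≠ 0` but `σ₁ ob₁ + σ₂ ob₂ = ∇_v ch(F) = 0`, then `σ` is NOT injective — a direct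
sum of sheaves whose summand classes individually leave the Hodge locus is never semiregular (and is
obstructed at first order along `v`). Pure additive-group algebra; proved. -/
theorem not_injective_of_blockAdditive {E E₁ E₂ H : Type*} [AddCommGroup E] [AddCommGroup E₁]
    [AddCommGroup E₂] [AddCommGroup H] (σ : E →+ H) (σ₁ : E₁ →+ H) (σ₂ : E₂ →+ H)
    (ι₁ : E₁ →+ E) (ι₂ : E₂ →+ E)
    (hind : ∀ x₁ x₂, ι₁ x₁ + ι₂ x₂ = 0 → x₁ = 0)
    (h₁ : σ.comp ι₁ = σ₁) (h₂ : σ.comp ι₂ = σ₂) (ob₁ : E₁) (ob₂ : E₂)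
    (hne : σ₁ ob₁ ≠ 0) (hsum : σ₁ ob₁ + σ₂ ob₂ = 0) : ¬ Function.Injective σ := by
  intro hinj
  have hob : σ (ι₁ ob₁ + ι₂ ob₂) = 0 := by
    rw [map_add, ← AddMonoidHom.comp_apply, ← AddMonoidHom.comp_apply, h₁, h₂, hsum]
  have hzero : ι₁ ob₁ + ι₂ ob₂ = 0 := hinj (by rw [hob, map_zero])
  have : ob₁ = 0 := hind _ _ hzero
  exact hne (by rw [this, map_zero])

/-! ### Isotypic first-order criterion (card `symmetry-ladder-isotypic-obstructions`) -/

section Isotypic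

variable {R : Type*} [Ring R] {T E H : Type*} [AddCommGroup T] [AddCommGroup E] [AddCommGroup H]
  [Module R T] [Module R E] [Module R H]

/-- The `T`-ISOTYPIC PART of `E` over `R` (intended `R = ℂ[G]`, `G` the finite automorphism group of
the anchor `(A₀, φ₀, h₀, F)`): the sum of the images of all `R`-linear (= `G`-equivariant) maps
`T → E`. -/
def isotypicPart (R : Type*) [Ring R] (T E : Type*) [AddCommGroup T] [AddCommGroup E] [Module R T]
    [Module R E] : Submodule R E :=
  ⨆ f : T →ₗ[R] E, LinearMap.range f

/-- FIRST LEMMA of card `symmetry-ladder-isotypic-obstructions`: if the (equivariant) semiregularity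
map `σ : Ext²(F,F) → ⊕ H^{q,q+2}` is injective on the `T`-isotypic part of `Ext²` (`T` = tangent
space of the Weil family at the anchor, a `G`-representation) and the equivariant first-order
obstruction map `ob = ev_F ∘ KS : T → Ext²` satisfies `σ ∘ ob = 0` (BF diagram: `σ ∘ ob = ⌟ch(F)`,
zero because `ch(F)` stays Hodge along the family), then `ob = 0`: `F` lifts to FIRST order along
EVERY direction of the family, invariant or not — only the isotypic types occurring in `T` need to
be tested, not all of `Ext²`. Proved (Schur-free form). -/
theorem obstruction_eq_zero_of_isotypic (σ : E →ₗ[R] H) (ob : T →ₗ[R] E)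
    (hσ : ∀ x ∈ isotypicPart R T E, σ x = 0 → x = 0) (hob : σ ∘ₗ ob = 0) : ob = 0 := by
  ext t
  have hmem : ob t ∈ isotypicPart R T E :=
    (le_iSup (fun f : T →ₗ[R] E => LinearMap.range f) ob) (LinearMap.mem_range_self ob t)
  have : σ (ob t) = 0 := by
    rw [← LinearMap.comp_apply, hob, LinearMap.zero_apply]
  simpa using hσ _ hmem this

end Isotypic

/-! ### Künneth stability of the Hochschild criterion (card `e-step-secant-induction`) -/

section Kunneth

open scoped TensorProduct

variable {𝕜 : Type*} [Field 𝕜] {A₁ A₂ B₁ B₂ C₁ C₂ : Type*} [AddCommGroup A₁] [AddCommGroup A₂]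
  [AddCommGroup B₁] [AddCommGroup B₂] [AddCommGroup C₁] [AddCommGroup C₂] [Module 𝕜 A₁]
  [Module 𝕜 A₂] [Module 𝕜 B₁] [Module 𝕜 B₂] [Module 𝕜 C₁] [Module 𝕜 C₂]

/-- FIRST LEMMA of card `e-step-secant-induction` (linear-algebra core of "Markman's criterion
`ker ev_F = ker (⌟ch F)`, `ev_F` onto, is stable under `⊠`"): over a field, if `ker ev_i = ker c_i`
and `ev_i` is surjective (`i = 1, 2`), the same holds for `ev₁ ⊗ ev₂` versus `c₁ ⊗ c₂` — the
`HH^a(X) ⊗ HH^b(E)` Künneth blocks of `HH²(X × E)` acting on `Ext(F₁ ⊠ F₂)`. -/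
theorem ker_map_eq_of_ker_eq (ev₁ : A₁ →ₗ[𝕜] B₁) (c₁ : A₁ →ₗ[𝕜] C₁) (ev₂ : A₂ →ₗ[𝕜] B₂)
    (c₂ : A₂ →ₗ[𝕜] C₂) (h₁ : LinearMap.ker ev₁ = LinearMap.ker c₁) (h₂ : LinearMap.ker ev₂ = LinearMap.ker c₂)
    (s₁ : Function.Surjective ev₁) (s₂ : Function.Surjective ev₂) :
    LinearMap.ker (TensorProduct.map ev₁ ev₂) = LinearMap.ker (TensorProduct.map c₁ c₂) ∧
      Function.Surjective (TensorProduct.map ev₁ ev₂) := by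
  refine ⟨?_, TensorProduct.map_surjective s₁ s₂⟩
  sorry

end Kunneth

/-! ### Where the lines land: the crux by name -/

/-- Shape check only: the sector statements feed the crux `HodgeAbelianVarieties` through the
Weil-class core (André 1992 for CM + transport for the rest — NOT claimed here). -/
example : Prop := Summit.HodgeConjecture.HodgeConjecture.Theses.PadicSemiregularLift.HodgeAbelianVarieties

end Summit.HodgeConjecture.HodgeConjecture.Cruxes.HodgeAbelianVarieties.IdeatorTwo
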